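import Literature.Analysis.FluidPDE.NSCriticalClosureBesovRecord
import HarnessLib

/-!
# The critical Besov continuation criterion without GKP (1.9): the assembly in a GKP exponent class

Analysis/FluidPDE assembly file (proofs only, no definitions or named facts) for the named fact
`Literature.Analysis.FluidPDE.hasSmoothExtensionPast_of_eHomBesovNorm_bounded`
(`NSCriticalClosure.lean`; Gallagher–Koch–Planchon 2016, Thm. 1, in contrapositive form for
classical Leray–Hopf solutions from rapidly decaying data: a bounded critical Besov norm
`Ḃ^{-1+3/r}_{r,q}`, `3 < r, q < ∞`, on `[0, T)` gives a smooth extension past `T`).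

State of the decomposition before this file (`NSCriticalClosureBesovRecord.lean`). The fact follows
from three named facts, `gkp_besov_blowup` (GKP Thm. 1), `tao2011_smooth_local_existence`
(Tao 2013, Thm. 5.4 (ii)+(iv)) and (L) `knss2009_local_smoothing ℝ³` (KNSS 2009, Prop. 4.1,
short-time form); opening GKP Thm. 1 along GKP §2.1 (`gkp_besov_blowup_of_gkp`) replaces it by
GKP (1.9) `gkp_regularity_persistence` (the maximal time does not depend on `(p, q)`: propagation
of regularity, Gallagher–Iftimie–Planchon 2003), Prop. 2.1 `gkp_exists_criticalElement`, Prop. 2.2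
`gkp_criticalElement_tendsto_zero` and the statement of Prop. 2.3 (an explicit hypothesis of
`gkp_besov_blowup_of_gkp`; its former tree-class rendering `gkp_rigidity` was merged back into the
proof obligation of Thm. 1 on review, 2026-08-15, being a corollary of `gkp_besov_blowup`,
`gkp_rigidity_of_gkp_besov_blowup`).

What this file proves. **GKP (1.9) is not needed for the continuation criterion.** In GKP §2.1,
(1.9) (with the embedding (1.1)) serves to reduce Thm. 1 for general `3 < p, q < ∞` to the case
`p = q = 3·2^k - 2`: a maximal solution in the class `(s_p, p, q)` must be shown maximal in the
larger class `(s_{p'}, p', p')` (`IsMaximalBesovMildSolution.of_critical_embedding`). For the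
*classical* solutions of the continuation criterion this transfer is free: the classical
Leray–Hopf solution `(u, U)` on `[0, T)` is a Besov mild solution in **every** class `(s_r, r, q)`,
`2 ≤ r < ∞`, `2 ≤ q` (`isBesovMildSolutionOn_of_classical`, Tao 2013), and if it does not extend
smoothly past `T` it is **maximal in every class** `3 < r < ∞`, `1 ≤ q < ∞`, because a Besov mild
extension in any such class is bounded on every `(0, T₁)` and hence smooth by the KNSS theory
(`hasSmoothExtensionPast_of_isBesovMildSolutionOn_extension_of_bounded`). So one runs GKP's
§2.1 argument directly in a GKP exponent class `(s_{p'}, p', p')`, `p' = 3·2^k - 2 ≥ max(r, q)`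
(`exists_isGKPExponent_ge`): the critical norm in that class is bounded by the embedding (1.1)
(`exists_eHomBesovNorm_critical_le` with the *theorem* `FunctionSpaces.besov_embedding_holds`),
while Thm. 1 in that exponent class — in GKP §2.1, Props. 2.1–2.3
(`limsup_eq_top_of_isGKPExponent`) — makes it blow up: contradiction.

* `hasSmoothExtensionPast_of_eHomBesovNorm_bounded_of_gkpExponent_knss` — the criterion from
  "GKP Thm. 1 for the exponents `p = q = 3·2^k - 2`" (spelled out, `limsup` form), the three Tao
  2013 facts and the KNSS smoothing fact of `NSCriticalClosureBesovBounded.lean`.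

(An earlier version also recorded `…_of_gkpProps3_taoLocal_knssLocal` / `…_of_and5`: the criterion
from the five named facts GKP Props. 2.1, 2.2, 2.3, Tao's Thm. 5.4 (ii)+(iv) and (L). The
tree-class rendering `gkp_rigidity` of Prop. 2.3 was merged back into the proof obligation of
Thm. 1 on review (2026-08-15, D-0026: mis-stated over the tree's class, Step 3 of the printed proof
by contradiction, and a corollary of `gkp_besov_blowup` itself, `gkp_rigidity_of_gkp_besov_blowup`),
so Prop. 2.3 is no longer a named fact of the tree and that record is dropped; it is the one-line
composition of `…_of_gkpExponent_knss` with `limsup_eq_top_of_isGKPExponent h1 h2 h3` — where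
`h3` is now the statement of Prop. 2.3 as an explicit hypothesis — the discharges
`tao2011_hasBoundedSobolevNormsOn_holds`, `tao2011_isMildNSSolutionOn_of_memSobolevX_holds` and
`knss_classical_of_bounded_isBesovMildSolutionOn_of_local`.)

Nothing is asserted beyond this implication; no statement of the tree is changed.

## Mathlib / tree search

Tree: `lean search '_holds' --decl` for the leaves — none of `gkp_besov_blowup`,
`gkp_regularity_persistence`, `gkp_exists_criticalElement`, `gkp_criticalElement_tendsto_zero`,
`tao2011_smooth_local_existence`, `knss2009_local_smoothing` is discharged (2026-08-15); discharged
and used here: `FunctionSpaces.besov_embedding_holds`,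
`tao2011_hasBoundedSobolevNormsOn_holds`, `tao2011_isMildNSSolutionOn_of_memSobolevX_holds`,
`tendsto_lowFreqCutoff_of_memLp_two_holds`, `eHomBesovNorm_le_of_sobolev_one_holds`, and (inside
`knss_classical_of_bounded_isBesovMildSolutionOn_of_local`) KNSS (A), (R), (C). The GKP §2.1
bookkeeping (`IsGKPExponent`, `exists_isGKPExponent_ge`, `exists_eHomBesovNorm_critical_le`,
`limsup_eq_top_of_isGKPExponent`, `limsup_nhdsLT_le_biSup_Ico`) is `GKPCriticalElements.lean` /
`CriticalRegularityProofs.lean`. Mathlib: no Navier–Stokes theory.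

## References

* I. Gallagher, G. S. Koch, F. Planchon, *Blow-up of critical Besov norms at a potential
  Navier–Stokes singularity*, Comm. Math. Phys. 343 (2016) 39–82 = arXiv:1407.4156: Thm. 1
  (p. 5), (1.1), (1.9) (p. 4), §2.1 (p. 6: "one can prove Theorem 1 in the case when `p = q`, and
  one can also choose `p` as large as needed … `p = 3·2^k - 2`"; Props. 2.1–2.3). [GKP2016]
* T. Tao, *Localisation and compactness properties of the Navier–Stokes global regularity
  problem*, Anal. PDE 6 (2013) 25–107 = arXiv:1108.1165, Thm. 5.4, Cor. 4.3, Cor. 11.1. [Tao2011]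
* G. Koch, N. Nadirashvili, G. Seregin, V. Šverák, *Liouville theorems for the Navier–Stokes
  equations and applications*, Acta Math. 203 (2009) 83–105 = arXiv:0709.3599, §4, Prop. 4.1.
  [KochNadirashviliSereginSverak2009]
-/

noncomputable section

open MeasureTheory TemperedDistribution Set Function Filter
open scoped SchwartzMap ENNReal NNReal
open _root_.Topology

namespace Literature.Analysis.FluidPDE

/-- A bounded supremum is monotone along a pointwise bound with a constant:
`g t ≤ C f t` for all `t` gives `sup_{t ∈ S} g t ≤ C sup_{t ∈ S} f t` (used to transport the
`sup` bound of the continuation criterion along the Besov embedding (1.1)). [folklore] -/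
theorem biSup_le_const_mul_biSup {S : Set ℝ} {C : ℝ≥0∞} {f g : ℝ → ℝ≥0∞}
    (hle : ∀ t, g t ≤ C * f t) : ⨆ t ∈ S, g t ≤ C * ⨆ t ∈ S, f t := by
  refine iSup₂_le fun t ht => (hle t).trans ?_
  gcongr
  exact le_iSup₂ (f := fun (t : ℝ) (_ : t ∈ S) => f t) t ht

/-- **The critical Besov continuation criterion from GKP's Theorem 1 for the exponents
`p = q = 3·2^k - 2` alone** (GKP 2016, Thm. 1 and §2.1, contrapositive; identification via Tao 2013
and the KNSS smoothing of bounded Besov mild solutions). Hypothesis `hG`: for every `ν > 0`, every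
GKP exponent `p` (`IsGKPExponent p`: `p + 2 = 3·2^k`, `k ≥ 2`) and every maximal Besov mild
solution `(u, U)` in the class `(s_p, p, p)` with finite lifespan `T > 0`,
`limsup_{t → T⁻} ‖U t‖_{Ḃ^{s_p}_{p,p}} = ∞` — the special case of `gkp_besov_blowup` to which GKP
reduce Thm. 1 in §2.1, and the conclusion of `limsup_eq_top_of_isGKPExponent` (Props. 2.1–2.3).
Conclusion: `hasSmoothExtensionPast_of_eHomBesovNorm_bounded`, given also the Tao 2013 facts
`tao2011_hasBoundedSobolevNormsOn`, `tao2011_isMildNSSolutionOn_of_memSobolevX`,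
`tao2011_smooth_local_existence` and the KNSS fact `knss_classical_of_bounded_isBesovMildSolutionOn`.
Proof. Let `(u, p)` be classical on `[0, T)`, Leray–Hopf from its rapidly decaying datum, with
`sup_{[0,T)} ‖U t‖_{Ḃ^{-1+3/r}_{r,q}} < ∞`, `3 < r, q < ∞`, and suppose it does not extend
smoothly past `T`. Choose a GKP exponent `p' ≥ max(r, q)` (`exists_isGKPExponent_ge`) and the
embedding constant `‖·‖_{Ḃ^{s_{p'}}_{p',p'}} ≤ C ‖·‖_{Ḃ^{s_r}_{r,q}}` (GKP (1.1):
`exists_eHomBesovNorm_critical_le` with `FunctionSpaces.besov_embedding_holds`), so that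
`sup_{[0,T)} ‖U t‖_{Ḃ^{s_{p'}}_{p',p'}} ≤ C sup_{[0,T)} ‖U t‖_{Ḃ^{s_r}_{r,q}} < ∞`. By Tao 2013,
`(u, U)` is a Besov mild solution on `[0, T)` in the class `(s_{p'}, p', p')`
(`isBesovMildSolutionOn_of_classical`, `p' ≥ 2`), and it is maximal there: `u` is bounded on
closed slabs (`exists_forall_norm_le_of_tao2011`), so a Besov mild extension in the class
`(s_{p'}, p', p')`, `3 < p' < ∞`, would be a smooth extension
(`hasSmoothExtensionPast_of_isBesovMildSolutionOn_extension_of_bounded`). Then `hG` gives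
`limsup_{t → T⁻} ‖U t‖_{Ḃ^{s_{p'}}_{p',p'}} = ∞ ≤ sup_{[0,T)} ‖U t‖_{Ḃ^{s_{p'}}_{p',p'}} < ∞`
(`limsup_nhdsLT_le_biSup_Ico`), a contradiction. GKP's (1.9) (persistence of regularity) is not
used: maximality is obtained in the exponent class directly. [cite: GKP2016, Thm. 1 and §2.1] -/
theorem hasSmoothExtensionPast_of_eHomBesovNorm_bounded_of_gkpExponent_knss
    (hG : ∀ ⦃ν : ℝ⦄, 0 < ν → ∀ ⦃p : ℝ≥0∞⦄ [Fact (1 ≤ p)], IsGKPExponent p → ∀ ⦃T : ℝ⦄, 0 < T →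
      ∀ ⦃u : ℝ → EuclideanSpace ℝ (Fin 3) → EuclideanSpace ℝ (Fin 3)⦄
        ⦃U : ℝ → 𝓢'(EuclideanSpace ℝ (Fin 3), EuclideanSpace ℂ (Fin 3))⦄,
        IsMaximalBesovMildSolution (-1 + 3 / p.toReal) p p T ν u U →
          limsup (fun t => FunctionSpaces.eHomBesovNorm (-1 + 3 / p.toReal) p p (U t))
            (𝓝[<] T) = ∞)
    (h₁ : tao2011_hasBoundedSobolevNormsOn) (h₂ : tao2011_isMildNSSolutionOn_of_memSobolevX)
    (hTao : tao2011_smooth_local_existence)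
    (hK : knss_classical_of_bounded_isBesovMildSolutionOn) :
    hasSmoothExtensionPast_of_eHomBesovNorm_bounded := by
  intro ν T hν hT u p U r q _ hr₃ hr hq₃ hq hsol hLH h₀ hU hsup
  -- a GKP exponent `p' = 3·2^k - 2 ≥ max(r, q)` and the embedding constant of (1.1)
  obtain ⟨p', hp', hrp', hqp'⟩ := exists_isGKPExponent_ge hr hq
  haveI : Fact (1 ≤ p') := ⟨hp'.one_le⟩
  have hq0 : q ≠ 0 := (lt_trans (by norm_num) hq₃).ne'
  obtain ⟨C, hC⟩ :=
    exists_eHomBesovNorm_critical_le FunctionSpaces.besov_embedding_holds hrp' hq0 hqp'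
  have hp'₂ : 2 ≤ p' := le_trans (by norm_num) hp'.three_lt.le
  -- step 1: `(u, U)` is a Besov mild solution on `[0, T)` in the class `(s_{p'}, p', p')`
  have hB : IsBesovMildSolutionOn (-1 + 3 / p'.toReal) p' p' T ν u U :=
    isBesovMildSolutionOn_of_classical h₁ h₂ hTao tendsto_lowFreqCutoff_of_memLp_two_holds
      eHomBesovNorm_le_of_sobolev_one_holds hν hT hsol hLH h₀ hU hp'₂ hp'.lt_top hp'₂
  -- the critical norm of the class `(s_{p'}, p', p')` is bounded on `[0, T)` by the embedding
  have hsup' : ⨆ t ∈ Ico 0 T, FunctionSpaces.eHomBesovNorm (-1 + 3 / p'.toReal) p' p' (U t) < ∞ :=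
    (biSup_le_const_mul_biSup fun t => hC (U t)).trans_lt
      (ENNReal.mul_lt_top ENNReal.coe_lt_top hsup)
  -- step 2: if `u` does not extend smoothly past `T`, then `(u, U)` is maximal in that class
  have hbdd := exists_forall_norm_le_of_tao2011 h₁ hν hsol hLH h₀
  by_contra hext
  have hmax : IsMaximalBesovMildSolution (-1 + 3 / p'.toReal) p' p' T ν u U := by
    refine ⟨hB, ?_⟩
    rintro ⟨T', hT', v, V, hv, hvu⟩
    exact hext (hasSmoothExtensionPast_of_isBesovMildSolutionOn_extension_of_bounded hK hν hT hT'
      hsol hbdd hp'.three_lt hp'.lt_top hp'.one_le hp'.lt_top hv hvu)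
  -- step 3: GKP Thm. 1 in the exponent class contradicts the bound
  have hlim := hG hν hp' hT hmax
  have hle : limsup (fun t => FunctionSpaces.eHomBesovNorm (-1 + 3 / p'.toReal) p' p' (U t))
      (𝓝[<] T) ≤ ⨆ t ∈ Ico 0 T, FunctionSpaces.eHomBesovNorm (-1 + 3 / p'.toReal) p' p' (U t) :=
    limsup_nhdsLT_le_biSup_Ico hT
  rw [hlim, top_le_iff] at hle
  exact hsup'.ne hle

end Literature.Analysis.FluidPDE

end
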